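import Summits.CriticalPhenomena.PercolationContinuityZ3.Theorems.PercNearOneGluingNoHeavyQuantRootScaledEqualRoots
import Summits.CriticalPhenomena.PercolationContinuityZ3.Theorems.PercNearOneGluingNoHeavyQuantAD3HeavyTop
import HarnessLib

/-!
# QUANT lane R8, T-DEC: THE TOP-LEVEL ROOT-SCALED EXPANSION, part 5 — the second certified regime of claim (II), at COUNT level: for EQUAL root
# gates the residual charges no atom below twice the least SURE PART of the siblings, so when `a·fmean L ≤ 4·rmin` every nonzero atom of the
# residual is self-sufficient and the node's obligation at outer gate `a` holds by the first-moment criterion — HEAVY-ROOTED siblings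
# (`fmean L ≤ 4·rmin`, e.g. the tied glued line `(R²[q](R s))³` at every light floor) are SDEC (arm-1 gen 49, architect)

builds on p205010 (kernel theorem, internal audit signed; external expert review pending)

Support file (`--supports stmt-CriticalPhenomena-4575`), QUANT lane seat prim-quant-arm-1 (gen 49, architect), rung R8 of
`run/shared/lean/prim/quant/LADDER.md`; memo `run/shared/lean/prim/quant/prim-quant-arm-1-g49/ARCH-G49.md` §1–§2.  Theorems only (no definitions, no
`@[conjecture]`), standard axioms, no sorries.  Sequel of arm-1 g48's `…QuantRootScaledEqualRoots` (`decAt_gate_flaw_equalRoots`: the regime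
`a·fmean ≤ 2·Smin`, pattern level) and `…QuantRootScaledExpansionStep` (`decAt_gate_flaw_of_resid`); uses the lane's first-moment criterion
`decAt_all_of_noLow` (`…QuantAD3HeavyTop`: a law whose only low atom is `0` is DEC at every layer).

THE OBSERVATION (count level, any sub-forest laws).  Write `rmin` for a common lower bound of the charged atoms of the sub-forest laws `ρᵢ` (`ρᵢ h = 0`
for `h < R`; for a sibling whose root carries `A` relays, `R = A`).  Along the list, for `0 < a ≤ 1`:
* (E) `flaw L h = rprod a L · flaw Lₐ h` for every `h < R` (below `R` only the all-roots-closed configuration charges, and `Π(1−qᵢ) = rprod·Π(1−aqᵢ)`;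
  `flaw_eq_rprod_mul_below`, any root gates);
* (D) for EQUAL root gates, `a·flaw L h = wco a L · flaw Lₐ h` for every `0 < h < 2R` (`flaw_gate_eq_wco_mul_below`): an atom below `2R` is charged by
  exactly one reached sibling, and on single-root patterns the expansion weight `wco = rfac^{k−1}` is exact (the cons step splits into the closed-root term,
  which is (D) for the tail since `wco (s :: L) = rfac s · wco L`, and the open-root term `aq·((flaw L − rprod L·flaw Lₐ) ∗ ρ_s)(h)`, which vanishes below
  `2R` by (E) and `ρ_s = 0` below `R`, since `wco (s :: L) = rprod L` for equal gates, `wco_cons_of_const`).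
Hence **`resid_eq_zero_below`**: for equal root gates the residual `resid a (wco a L) L` of the top-level expansion charges NO atom `0 < h < 2R` — at
count level what `resid_rootPattern` says at pattern level (no single-root pieces), sharpened by the sure parts: the pieces `F_U`, `|U| ≥ 2`, charge only
atoms `≥ Σ_{i∈U} Aᵢ ≥ 2R`.

THE REGIME.  If moreover `a·fmean L ≤ 4R`, every nonzero charged atom `h ≥ 2R` of the residual is SELF-SUFFICIENT (`2h ≥ a·fmean L`, its mean), so the
residual is DEC at floor `a·x` at every layer below the top by `decAt_all_of_noLow` (top-affordability `x·ftop ≤ fmean` from the tree-built members) —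
**`decAt_resid_of_noLow`** — and with part 2: **`decAt_gate_flaw_heavyRoots`** (equal root gates, `0 < a < 1`, `a·fmean L ≤ 4R` ⟹ the node's
obligation at outer gate `a`) and **`sdec_flaw_heavyRoots`** (equal root gates, `fmean L ≤ 4R` ⟹ `SDEC x (ftop L) (flaw L)`, the list form of
`SiblingStep` on this family, every width, oracle given).  COMPARISON with part 4 (`a·fmean ≤ 2·Smin`, `Smin` = least sub-forest MEAN): the new regime is
the larger one iff `2R ≥ Smin`, i.e. for HEAVY-ROOTED siblings (sure root part at least the pendant mean) — exactly the glued-root siblings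
`R^A[q](R^B[s])` with `A ≥ B·s` of the lane's light core (README V422–V427), which are hull-irreducible when `q(A + Bs) > A` (`…QuantGluedPairMix`):
for the TIED GLUED LINE `(R²[q](R s))³` (README V422's named minimal open family) `R = 2` and `fmean = 3q(2+s) ≤ 7.5 < 8` on the whole light region
`qs ≤ 1/2`, so it is SDEC at every outer gate with NO count-level certificate (the explicit family is filed separately, `…QuantGluedForestSDEC`);
census-2's regression witness `(R¹[q](R²[s]))³` (`R = 1`) is NOT covered (its residual charges the low atom `2` once `a·fmean > 4`), nor is `k ≥ 4`
beyond `k·q·(A + Bs) ≤ 4A`.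

* tools `lconv_eq_zero_below_right`, `lconv_eq_zero_below`, `ftop_mul_floor_le_fmean`;
* **`flaw_eq_rprod_mul_below`** (E), **`flaw_gate_eq_wco_mul_below`** (D), **`resid_eq_zero_below`**;
* **`decAt_resid_of_noLow`**, **`decAt_gate_flaw_heavyRoots`**, **`sdec_flaw_heavyRoots`**.

HONEST STATUS: a certified sub-family (equal root gates, `fmean ≤ 4·rmin`); `SiblingStep`, `GateStepN`, `FarTreeRow` OPEN; RATE class log\* /
honest sentence of `run/shared/lean/prim/quant/README.md` unchanged.  [this work]; first-moment criterion: this lane (`…QuantAD3HeavyTop`); programme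
(I)–(II): prim-quant-lead g46; expansion in the binder: prim-quant-arm-1 g48.  Nothing here is cited as a published result.  The gluing rows served
[cite: KozmaNitzan2024, Conjecture 3 (p. 15)]; product measure [cite: Grimmett1999, §1.3 p. 10].
-/

noncomputable section

open scoped BigOperators

namespace Summit.CriticalPhenomena.PercolationContinuityZ3.Theorems
namespace Quant
namespace LawDec

open Finset

/-! ### Tools: a convolution vanishes below the sum of the supports' lower ends -/

/-- if the right factor vanishes below `R`, so does the convolution. [this work] -/
theorem lconv_eq_zero_below_right (M₁ M₂ : ℕ) (μ ν : ℕ → ℝ) (R : ℕ) (hν : ∀ k, k < R → ν k = 0) (h : ℕ) (hh : h < R) :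
    lconv M₁ M₂ μ ν h = 0 := by
  simp only [lconv]
  refine Finset.sum_eq_zero fun i _ => Finset.sum_eq_zero fun k _ => ?_
  split_ifs with hik
  · rw [hν k (by omega), mul_zero]
  · rfl

/-- if the factors vanish below `R₁` and `R₂`, the convolution vanishes below `R₁ + R₂`. [this work] -/
theorem lconv_eq_zero_below (M₁ M₂ : ℕ) (μ ν : ℕ → ℝ) (R₁ R₂ : ℕ) (hμ : ∀ k, k < R₁ → μ k = 0) (hν : ∀ k, k < R₂ → ν k = 0)
    (h : ℕ) (hh : h < R₁ + R₂) : lconv M₁ M₂ μ ν h = 0 := by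
  simp only [lconv]
  refine Finset.sum_eq_zero fun i _ => Finset.sum_eq_zero fun k _ => ?_
  split_ifs with hik
  · by_cases hi : i < R₁
    · rw [hμ i hi, zero_mul]
    · rw [hν k (by omega), mul_zero]
  · rfl

/-- **top-affordability of a forest of tree-built siblings**: `x·ftop L ≤ fmean L`. [this work] -/
theorem ftop_mul_floor_le_fmean {x : ℝ} (hx0 : 0 < x) (hx1 : x < 1) (L : List Sib) (hL : ∀ s ∈ L, s.TreeOK x) :
    x * (ftop L : ℝ) ≤ fmean L := by
  obtain ⟨_, _, _, _, _, wta⟩ := (compForestN_of_list hx0 hx1 L hL).treeBuiltN.lawFacts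
  obtain ⟨_, _, _, fmn⟩ := flaw_facts L (fun s hs => (hL s hs).lawOK)
  rw [fmn] at wta
  exact wta

/-! ### (E): below the least sure part only the all-closed configuration charges -/

/-- **(E)** for `0 < a ≤ 1` and sub-forest laws vanishing below `R`: `flaw L h = rprod a L · flaw Lₐ h` for every `h < R` (any root gates). [this work] -/
theorem flaw_eq_rprod_mul_below {a : ℝ} (ha0 : 0 < a) (ha1 : a ≤ 1) (R : ℕ) :
    ∀ L : List Sib, (∀ s ∈ L, s.LawOK) → (∀ s ∈ L, ∀ h, h < R → s.ρ h = 0) →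
      ∀ h, h < R → flaw L h = rprod a L * flaw (L.map (Sib.scale a)) h
  | [], _, _, h, _ => by simp [rprod]
  | s :: L, hL, hR, h, hh => by
    have hs := hL s List.mem_cons_self
    have hL' : ∀ t ∈ L, t.LawOK := fun t ht => hL t (List.mem_cons_of_mem s ht)
    have hR' : ∀ t ∈ L, ∀ k, k < R → t.ρ k = 0 := fun t ht => hR t (List.mem_cons_of_mem s ht)
    have hRs : ∀ k, k < R → s.ρ k = 0 := hR s List.mem_cons_self
    obtain ⟨_, fM, _, _⟩ := flaw_facts L hL'
    obtain ⟨_, faM, _, _⟩ := flaw_facts (L.map (Sib.scale a)) (map_scale_lawOK ha0 ha1 L hL')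
    rw [ftop_map_scale] at faM
    obtain ⟨_, _, hrq, _, _⟩ := rfac_facts ha1 hs
    have ih : flaw L h = rprod a L * flaw (L.map (Sib.scale a)) h := flaw_eq_rprod_mul_below ha0 ha1 R L hL' hR' h hh
    rw [flaw_map_scale_cons]
    simp only [flaw, rprod]
    rw [lconv_gate_right _ _ _ _ _ fM h, lconv_gate_right _ _ _ _ _ faM h,
      lconv_eq_zero_below_right _ _ _ _ R hRs h hh, lconv_eq_zero_below_right _ _ _ _ R hRs h hh, ih, ← hrq]
    ring

/-! ### (D): below twice the least sure part the expansion weight is exact (equal root gates) -/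

/-- **(D)** for EQUAL root gates, `0 < a ≤ 1` and sub-forest laws vanishing below `R`: `a·flaw L h = wco a L · flaw Lₐ h` for every `0 < h < 2R`.
[this work] -/
theorem flaw_gate_eq_wco_mul_below {a : ℝ} (ha0 : 0 < a) (ha1 : a ≤ 1) (R : ℕ) (q₀ : ℝ) :
    ∀ L : List Sib, (∀ s ∈ L, s.LawOK) → (∀ u ∈ L, u.q = q₀) → (∀ s ∈ L, ∀ h, h < R → s.ρ h = 0) →
      ∀ h, 0 < h → h < 2 * R → a * flaw L h = wco a L * flaw (L.map (Sib.scale a)) h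
  | [], _, _, _, h, hh0, _ => by
    simp only [flaw, wco, List.map_nil]
    rw [if_neg (by omega)]
    ring
  | [s], hL, _, _, h, hh0, _ => by
    obtain ⟨hq0, hq1, ρ0, ρM, ρ1⟩ := hL s List.mem_cons_self
    obtain ⟨_, gM, _⟩ := gate_laws s.M s.ρ s.q hq0.le hq1.le ρ0 ρM ρ1
    obtain ⟨_, gaM, _⟩ := gate_laws s.M s.ρ (a * s.q) (by nlinarith) (by nlinarith) ρ0 ρM ρ1
    have e1 : flaw [s] h = gate s.ρ s.q h := by
      simp only [flaw, ftop]; exact lconv_delta_left 0 s.M _ gM h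
    have e2 : flaw ([s].map (Sib.scale a)) h = gate s.ρ (a * s.q) h := by
      rw [flaw_map_scale_cons]
      simp only [flaw, ftop, List.map_nil]
      exact lconv_delta_left 0 s.M _ gaM h
    rw [e1, e2, gate_apply, gate_apply, if_neg (by omega)]
    simp only [wco]
    ring
  | s :: t :: L, hL, hq, hR, h, hh0, hh => by
    have hs := hL s List.mem_cons_self
    have hL' : ∀ u ∈ t :: L, u.LawOK := fun u hu => hL u (List.mem_cons_of_mem s hu)
    have hq' : ∀ u ∈ t :: L, u.q = q₀ := fun u hu => hq u (List.mem_cons_of_mem s hu)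
    have hR' : ∀ u ∈ t :: L, ∀ k, k < R → u.ρ k = 0 := fun u hu => hR u (List.mem_cons_of_mem s hu)
    have hRs : ∀ k, k < R → s.ρ k = 0 := hR s List.mem_cons_self
    obtain ⟨hq0, hq1, _, _, _⟩ := hs
    obtain ⟨_, fM, _, _⟩ := flaw_facts (t :: L) hL'
    obtain ⟨_, faM, _, _⟩ := flaw_facts ((t :: L).map (Sib.scale a)) (map_scale_lawOK ha0 ha1 (t :: L) hL')
    rw [ftop_map_scale] at faM
    obtain ⟨_, _, hrq, _, _⟩ := rfac_facts ha1 (hL s List.mem_cons_self)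
    obtain ⟨hWP, hWr'⟩ := wco_cons_of_const a q₀ (t :: L) s hq
    have hWr : wco a (s :: t :: L) = rfac a s * wco a (t :: L) := hWr' (List.cons_ne_nil t L)
    -- (D) for the tail
    have ih : a * flaw (t :: L) h = wco a (t :: L) * flaw ((t :: L).map (Sib.scale a)) h :=
      flaw_gate_eq_wco_mul_below ha0 ha1 R q₀ (t :: L) hL' hq' hR' h hh0 hh
    -- the open-root term: `(flaw L' − rprod L'·flaw L'ₐ) ∗ ρ_s` vanishes below `2R` by (E) and the support of `ρ_s`
    have key : lconv (ftop (t :: L)) s.M (flaw (t :: L)) s.ρ h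
        = rprod a (t :: L) * lconv (ftop (t :: L)) s.M (flaw ((t :: L).map (Sib.scale a))) s.ρ h := by
      have e : lconv (ftop (t :: L)) s.M
          (fun i => 1 * flaw (t :: L) i + (-(rprod a (t :: L))) * flaw ((t :: L).map (Sib.scale a)) i) s.ρ h = 0 :=
        lconv_eq_zero_below _ _ _ _ R R
          (fun i hi => by rw [flaw_eq_rprod_mul_below ha0 ha1 R (t :: L) hL' hR' i hi]; ring) hRs h (by omega)
      rw [lconv_lin_left] at e
      linarith
    rw [show flaw (s :: t :: L) h = lconv (ftop (t :: L)) s.M (flaw (t :: L)) (gate s.ρ s.q) h from rfl, flaw_map_scale_cons,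
      lconv_gate_right _ _ _ _ _ fM h, lconv_gate_right _ _ _ _ _ faM h]
    set c := lconv (ftop (t :: L)) s.M (flaw ((t :: L).map (Sib.scale a))) s.ρ h with hc
    set f := flaw ((t :: L).map (Sib.scale a)) h with hf
    calc a * (s.q * lconv (ftop (t :: L)) s.M (flaw (t :: L)) s.ρ h + (1 - s.q) * flaw (t :: L) h)
        = s.q * (rprod a (t :: L) * (a * c)) + (1 - s.q) * (a * flaw (t :: L) h) := by rw [key]; ring
      _ = s.q * (rprod a (t :: L) * (a * c)) + (rfac a s * (1 - a * s.q)) * (wco a (t :: L) * f) := by rw [hrq, ih]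
      _ = rprod a (t :: L) * (a * s.q * c) + (rfac a s * wco a (t :: L)) * ((1 - a * s.q) * f) := by ring
      _ = wco a (s :: t :: L) * (a * s.q * c) + wco a (s :: t :: L) * ((1 - a * s.q) * f) := by rw [← hWP, ← hWr]
      _ = wco a (s :: t :: L) * (a * s.q * c + (1 - a * s.q) * f) := by ring

/-- **THE RESIDUAL CHARGES NO ATOM BELOW TWICE THE LEAST SURE PART** (equal root gates, `w = wco a L < 1`, `0 < a ≤ 1`, sub-forest laws vanishing
below `R`): `resid a (wco a L) L h = 0` for every `0 < h < 2R`. [this work] -/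
theorem resid_eq_zero_below {a : ℝ} (ha0 : 0 < a) (ha1 : a ≤ 1) (R : ℕ) (q₀ : ℝ) (L : List Sib) (hL : ∀ s ∈ L, s.LawOK)
    (hq : ∀ u ∈ L, u.q = q₀) (hR : ∀ s ∈ L, ∀ h, h < R → s.ρ h = 0)
    (h : ℕ) (hh0 : 0 < h) (hh : h < 2 * R) : resid a (wco a L) L h = 0 := by
  simp only [resid]
  rw [gate_apply, if_neg (by omega), mul_zero, add_zero, flaw_gate_eq_wco_mul_below ha0 ha1 R q₀ L hL hq hR h hh0 hh, sub_self, zero_div]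

/-! ### The certified regime: heavy-rooted siblings -/

/-- **THE RESIDUAL IS DEC WHEN ITS NONZERO ATOMS ARE SELF-SUFFICIENT.**  Tree-built siblings at floor `0 < x < 1` with EQUAL root gates, at least two of
them (`wco a L < 1`), sub-forest laws vanishing below `R`, `0 < a ≤ 1` and THE REGIME `a·fmean L ≤ 4R`: then `resid a (wco a L) L` is DEC at floor `a·x`
at every layer below the top — its only low atom is `0` (`resid_eq_zero_below` + `2h ≥ 4R ≥ a·fmean` for `h ≥ 2R`), first-moment criterion
`decAt_all_of_noLow`. [this work] -/
theorem decAt_resid_of_noLow {x a : ℝ} (hx0 : 0 < x) (hx1 : x < 1) (ha0 : 0 < a) (ha1 : a ≤ 1) (R : ℕ) (q₀ : ℝ) (L : List Sib)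
    (hL : ∀ s ∈ L, s.TreeOK x) (hq : ∀ u ∈ L, u.q = q₀) (hR : ∀ s ∈ L, ∀ h, h < R → s.ρ h = 0)
    (hw1 : wco a L < 1) (hreg : a * fmean L ≤ 4 * (R : ℝ)) :
    ∀ j, j < ftop L → DECAt (a * x) j (ftop L) (resid a (wco a L) L) := by
  have hL' : ∀ s ∈ L, s.LawOK := fun s hs => (hL s hs).lawOK
  obtain ⟨r0, rM, r1, rmn⟩ := resid_laws ha0 ha1 L hL' le_rfl hw1
  have hax0 : 0 < a * x := mul_pos ha0 hx0
  have hax1 : a * x < 1 := by nlinarith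
  have hta : a * x * (ftop L : ℝ) ≤ ∑ h ∈ Finset.range (ftop L + 1), (h : ℝ) * resid a (wco a L) L h := by
    rw [rmn, mul_assoc]
    exact mul_le_mul_of_nonneg_left (ftop_mul_floor_le_fmean hx0 hx1 L hL) ha0.le
  refine decAt_all_of_noLow (a * x) (ftop L) (resid a (wco a L) L) hax0 hax1 r0 rM r1 hta (fun h h1 hpos => ?_)
  rw [rmn]
  by_contra hlt
  have h2R : h < 2 * R := by
    have : (2 : ℝ) * (h : ℝ) < 4 * (R : ℝ) := by linarith
    have : ((2 * h : ℕ) : ℝ) < ((4 * R : ℕ) : ℝ) := by push_cast; linarith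
    have := Nat.cast_lt.1 this
    omega
  exact absurd (resid_eq_zero_below ha0 ha1 R q₀ L hL' hq hR h (by omega) h2R) (ne_of_gt hpos)

/-- **EQUAL ROOT GATES, HEAVY ROOTS: the node's obligation at outer gate `a`.**  Tree-built siblings at floor `0 < x < 1` with a common root gate,
`L ≠ []`, SDEC sub-forest laws (the oracle of the sibling step supplies them, `sdec_members_of_oracle`) vanishing below `R`, `0 < a < 1` and
`a·fmean L ≤ 4R`: `gate (flaw L) a` is DEC at floor `a·x` at every layer below the top (product part free, residual by `decAt_resid_of_noLow`). [this work] -/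
theorem decAt_gate_flaw_heavyRoots {x a q₀ : ℝ} (hx0 : 0 < x) (hx1 : x < 1) (ha0 : 0 < a) (ha1 : a < 1) (R : ℕ) (L : List Sib) (hne : L ≠ [])
    (hL : ∀ s ∈ L, s.TreeOK x) (hq : ∀ u ∈ L, u.q = q₀) (hρ : ∀ s ∈ L, SDEC s.x₁ s.M s.ρ)
    (hR : ∀ s ∈ L, ∀ h, h < R → s.ρ h = 0) (hreg : a * fmean L ≤ 4 * (R : ℝ)) :
    ∀ j, j < ftop L → DECAt (a * x) j (ftop L) (gate (flaw L) a) := by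
  have hL' : ∀ s ∈ L, s.LawOK := fun s hs => (hL s hs).lawOK
  obtain ⟨hW0, _, _⟩ := wco_facts ha1.le L hL'
  intro j hj
  rcases L with _ | ⟨s, _ | ⟨t, L⟩⟩
  · exact absurd rfl hne
  · -- one sibling: `gate (flaw [s]) a = gate ρ (a q₀)`, SDEC of `ρ`
    obtain ⟨hsq0, hsq1, hxq, hT, _⟩ := hL s List.mem_cons_self
    obtain ⟨_, hx₁1, ρ0, ρM, ρ1, _⟩ := hT.lawFacts
    obtain ⟨_, gM, _⟩ := gate_laws s.M s.ρ s.q hsq0.le hsq1.le ρ0 ρM ρ1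
    have e1 : flaw [s] = gate s.ρ s.q := by
      funext k; simp only [flaw, ftop]; exact lconv_delta_left 0 s.M _ gM k
    have hS : SDEC s.x₁ s.M s.ρ := hρ s List.mem_cons_self
    have htop : ftop [s] = s.M := by simp [ftop]
    rw [htop] at hj ⊢
    rw [e1, gate_gate]
    have d := hS (a * s.q) (mul_pos ha0 hsq0) (by nlinarith) j hj
    exact decAt_mono_floor (by nlinarith [mul_le_mul_of_nonneg_left hxq ha0.le]) (by nlinarith) d
  · have hlt : wco a (s :: t :: L) < 1 := wco_lt_one ha1 s t L hL'
    exact decAt_gate_flaw_of_resid hx0 hx1 ha0 ha1.le (s :: t :: L) hL hρ hW0.le le_rfl hlt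
      (decAt_resid_of_noLow hx0 hx1 ha0 ha1.le R q₀ (s :: t :: L) hL hq hR hlt hreg) j hj

/-- **THE SIBLING STEP FOR EQUAL ROOT GATES AND HEAVY ROOTS (any width).**  Tree-built siblings at floor `0 < x < 1` with a common root gate `q₀` and
SDEC sub-forest laws (GIVEN by the oracle of the sibling step, `sdec_members_of_oracle`) vanishing below `R`: if `fmean L ≤ 4R` (`q₀·Σ mᵢ ≤ 4·rmin`;
identical glued siblings `R^A[q](R^B[s])`: `k·q·(A + Bs) ≤ 4A` — the tied glued line `(R²[q](R s))³` at every floor `qs ≤ 2/3`), then `flaw L` is SDEC at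
`x` — the list form of `SiblingStep` on this family. [this work] -/
theorem sdec_flaw_heavyRoots {x q₀ : ℝ} (hx0 : 0 < x) (hx1 : x < 1) (R : ℕ) (L : List Sib) (hL : ∀ s ∈ L, s.TreeOK x)
    (hq : ∀ u ∈ L, u.q = q₀) (hρ : ∀ s ∈ L, SDEC s.x₁ s.M s.ρ) (hR : ∀ s ∈ L, ∀ h, h < R → s.ρ h = 0)
    (hheavy : fmean L ≤ 4 * (R : ℝ)) : SDEC x (ftop L) (flaw L) := by
  intro a ha0 ha1 j hj
  have hne : L ≠ [] := by rintro rfl; simp [ftop] at hj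
  rcases eq_or_lt_of_le ha1 with rfl | hlt
  · rw [gate_one, one_mul]
    exact decAt_flaw_of_sdec hx0 hx1 L hL hρ j
  · refine decAt_gate_flaw_heavyRoots hx0 hx1 ha0 hlt R L hne hL hq hρ hR ?_ j hj
    have : a * fmean L ≤ 1 * fmean L := mul_le_mul_of_nonneg_right ha1 (fmean_pos L hL).1
    linarith

/-- **the same under the oracle of the sibling step** (the induction hypothesis below `fgates L` supplies SDEC of every sub-forest law). [this work] -/
theorem sdec_flaw_heavyRoots_of_oracle {x q₀ : ℝ} (hx0 : 0 < x) (hx1 : x < 1) (R : ℕ) (L : List Sib) (hL : ∀ s ∈ L, s.TreeOK x)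
    (hq : ∀ u ∈ L, u.q = q₀)
    (hO : ∀ (x' : ℝ) (n' M' : ℕ) (μ' : ℕ → ℝ), n' < fgates L → TreeBuiltN x' n' M' μ' → SDEC x' M' μ')
    (hR : ∀ s ∈ L, ∀ h, h < R → s.ρ h = 0) (hheavy : fmean L ≤ 4 * (R : ℝ)) : SDEC x (ftop L) (flaw L) :=
  sdec_flaw_heavyRoots hx0 hx1 R L hL hq (sdec_members_of_oracle L hL hO) hR hheavy


end LawDec
end Quant
end Summit.CriticalPhenomena.PercolationContinuityZ3.Theorems
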